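import Summits.QuantumFields.BalabanUV.InfraRed.StrongCouplingForestGauge

/-!
# Strong-coupling front, J-SC18: the STAGGERED TEMPORAL FOREST has Dobrushin row `15` — the first combinatorial rung
of the forest-gauge ladder, PROVED (leaf 25) — observatory of the non-perturbative crossover; no mass-gap claim

IR-3 v2 TWO-FRONT CROSSOVER LEDGER, front SC (`β₀`), SU(2), `d = 4`, Wilson normalisation `β_W = 4/g²`.
ABSOLUTE RULE of this package: No internally-minted statement may enter as a cited fact. Every hypothesis is either
kernel-proved in this package or a verbatim quotation of a PUBLISHED theorem with page reference. The manuscript(s)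
under audit are NOT citable for their own disputed steps — they are the thing under adjudication; programme-internal
(2001/route/tribunal) claims are never citable.  Nothing is cited here: every statement below is kernel-proved
elementary combinatorics of the discrete torus ([folklore] labels are attributions, not citations).

## What this file is

Theorem-only companion of `StrongCouplingForestGauge` (leaf 24).  For the staggered temporal forest
`staggerForest L` of the torus `(ℤ/L)⁴` (time = coordinate `3`; over the spatial site `x⃗` every time-like link is
frozen except the one leaving time `t₀(x⃗) = 2(x₀+x₁+x₂)`):
* `forestRowBound_stagger : 4 ≤ L → ForestRowBound (staggerForest L) 15` — every dynamic link keeps at most `15` of its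
  `18` (plaquette, staple-slot) pairs dynamic.  Space-like link `(x + e₃, i)`: the four time-like staple links on the two
  `(i,3)`-plaquettes through it have staggering phases `a−1, a+1, a−2, a` (`a` the phase of `x`), a time-like link is
  dynamic iff its phase is `1`, and the four conditions `a = 2, 0, 3, 1` exclude each other once `L ≥ 4`
  (`forestRow_stagger_spatial`); dynamic time-like link `(x, 3)` (phase `1`): on each of its three plaquettes
  `(x, (j,3))` the opposite time-like link `(x + e_j, 3)` has phase `1 − 2 ≠ 1` and is frozen, so the row is `12`
  (`forestRow_stagger_temporal`);
* `isRankedForest_stagger : 1 < L → IsRankedForest (staggerForest L) stagRank` — along a frozen time-like link the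
  staggered rank `val(t₀(x⃗) − x₃)` drops by exactly one (`stagRank_shift_three`), so every frozen link has its base
  point as strict upper end and distinct frozen links have distinct upper ends;
* `eventualForestRowBound_fifteen : EventualForestRowBound 15` (sides `2S+1 ≥ 5`), and the what-if with its
  combinatorial hypothesis DISCHARGED: `su2_strongCouplingFront_whatIf15 : ForestDobrushinDoor →
  QuarterModulusUpTo (4/15) → 0 ≤ β_W < 4/15 → StrongCouplingFront (fundamentalLatticeRep 2) (β_W/2)`.
Two independent finite checks of the row bound preceded the proof (records `ir/data/FRONT-SC-JSC17-forestgauge.txt`,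
(B3): exhaustive row tables on `L = 5, 7` by two engines; `L = 3` gives `16`, consistent with the hypothesis `4 ≤ L`).

NOT CLAIMED: any certified threshold beyond the owned `β_W < 2/9`; `4/15 = 0.2667` is conditional on the two
`@[conjecture]` schemas of leaf 24 (forest gauge fixing + frozen-specification Dobrushin door; quarter modulus up to
`κ = 1.6`).  No mass-gap claim.
-/

noncomputable section

open Finset
open Literature.MathematicalPhysics.QuantumFieldTheory
open Literature.MathematicalPhysics.QuantumLattice (fundamentalRep fundamentalLatticeRep)
open Literature.MathematicalPhysics.QuantumFieldTheory.Balaban1983to89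
open Literature.MathematicalPhysics.QuantumFieldTheory.Balaban1983to89.StrongCouplingDobrushinWindow
open Literature.MathematicalPhysics.QuantumFieldTheory.Balaban1983to89.StrongCouplingTorusWindow
open Summit.QuantumFields.BalabanUV.InfraRed.StrongCouplingForestGauge

namespace Summit.QuantumFields.BalabanUV.InfraRed.StrongCouplingStaggerForest

section Stagger

variable {L : ℕ} [NeZero L]

omit [NeZero L] in
/-- The staggering time is blind to the time coordinate. [folklore] -/
theorem stagTime_shift_three (x : Site 4 L) : stagTime (x.shift 3) = stagTime x := by
  simp [stagTime, Site.shift]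

omit [NeZero L] in
/-- The staggering time grows by `2` along every spatial direction. [folklore] -/
theorem stagTime_shift_ne (x : Site 4 L) {i : Fin 4} (hi : i ≠ 3) : stagTime (x.shift i) = stagTime x + 2 := by
  fin_cases i <;> simp_all [stagTime, Site.shift] <;> ring

omit [NeZero L] in
/-- The staggering phase grows by `1` along time. [folklore] -/
theorem stagPhase_shift_three (x : Site 4 L) : stagPhase (x.shift 3) = stagPhase x + 1 := by
  have h3 : (x.shift 3) 3 = x 3 + 1 := by simp [Site.shift]
  simp only [stagPhase, stagTime_shift_three, h3]
  ring

omit [NeZero L] in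
/-- The staggering phase drops by `2` along every spatial direction. [folklore] -/
theorem stagPhase_shift_ne {x : Site 4 L} {i : Fin 4} (hi : i ≠ 3) : stagPhase (x.shift i) = stagPhase x - 2 := by
  have h3 : (x.shift i) 3 = x 3 := by simp [Site.shift, hi.symm]
  simp only [stagPhase, stagTime_shift_ne x hi, h3]
  ring

omit [NeZero L] in
/-- `0, 1, 2, 3` are pairwise distinct residues once `L ≥ 4`. [folklore] -/
theorem zmod_small_ne (hL : 4 ≤ L) :
    (0 : ZMod L) ≠ 1 ∧ (0 : ZMod L) ≠ 2 ∧ (0 : ZMod L) ≠ 3 ∧ (1 : ZMod L) ≠ 2 ∧ (1 : ZMod L) ≠ 3 ∧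
      (2 : ZMod L) ≠ 3 := by
  have key : ∀ m n : ℕ, m < L → n < L → m ≠ n → (m : ZMod L) ≠ (n : ZMod L) := by
    intro m n hm hn hmn h
    apply hmn
    have := congrArg ZMod.val h
    rwa [ZMod.val_natCast_of_lt hm, ZMod.val_natCast_of_lt hn] at this
  refine ⟨?_, ?_, ?_, ?_, ?_, ?_⟩
  · exact_mod_cast key 0 1 (by omega) (by omega) (by omega)
  · exact_mod_cast key 0 2 (by omega) (by omega) (by omega)
  · exact_mod_cast key 0 3 (by omega) (by omega) (by omega)
  · exact_mod_cast key 1 2 (by omega) (by omega) (by omega)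
  · exact_mod_cast key 1 3 (by omega) (by omega) (by omega)
  · exact_mod_cast key 2 3 (by omega) (by omega) (by omega)

omit [NeZero L] in
/-- The staple links of a plaquette seen from its first link. [folklore] -/
theorem tstapleLinks_tLink1 {d : ℕ} (q : Plaquette d L) :
    tstapleLinks q (tLink1 q) = ![tLink2 q, tLink3 q, tLink4 q] := by
  simp [tstapleLinks]

/-- The staple links of a plaquette seen from its third link (`L ≥ 2`). [folklore] -/
theorem tstapleLinks_tLink3 {d : ℕ} (hL : 1 < L) (q : Plaquette d L) :
    tstapleLinks q (tLink3 q) = ![tLink2 q, tLink1 q, tLink4 q] := by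
  have h1 : tLink3 q ≠ tLink1 q := (tLink1_ne_tLink3 hL q).symm
  have h2 : tLink3 q ≠ tLink2 q := (tLink2_ne_tLink3 q).symm
  simp [tstapleLinks, h1, h2]

/-- The staple links of a plaquette seen from its fourth link (`L ≥ 2`). [folklore] -/
theorem tstapleLinks_tLink4 {d : ℕ} (hL : 1 < L) (q : Plaquette d L) :
    tstapleLinks q (tLink4 q) = ![tLink3 q, tLink2 q, tLink1 q] := by
  have h1 : tLink4 q ≠ tLink1 q := (tLink1_ne_tLink4 q).symm
  have h2 : tLink4 q ≠ tLink2 q := (tLink2_ne_tLink4 hL q).symm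
  have h3 : tLink4 q ≠ tLink3 q := (tLink3_ne_tLink4 q).symm
  simp [tstapleLinks, h1, h2, h3]

omit [NeZero L] in
/-- At most one of four mutually exclusive residue conditions holds: the indicator count is `≤ 1`. [folklore] -/
theorem indicator_four_le_one (hL : 4 ≤ L) (a : ZMod L) :
    (if a = 2 then 1 else 0) + (if a = 0 then 1 else 0) + ((if a = 3 then 1 else 0) + (if a = 1 then 1 else 0)) ≤
      (1 : ℕ) := by
  obtain ⟨h01, h02, h03, h12, h13, h23⟩ := zmod_small_ne hL
  by_cases h0 : a = 0
  · subst h0; simp [h01, h02, h03]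
  by_cases h1 : a = 1
  · subst h1; simp [h01.symm, h12, h13]
  by_cases h2 : a = 2
  · subst h2; simp [h02.symm, h12.symm, h23]
  by_cases h3 : a = 3
  · subst h3; simp [h03.symm, h13.symm, h23.symm]
  simp [h0, h1, h2, h3]

/-- **Space-like links have forest row `≤ 15`** (`L ≥ 4`): of the four time-like staple links of `e = (x + e₃, i)`
(two on the plaquette above, two on the plaquette below `e` in the `(i,3)` plane) at most one is dynamic, because
their phases are `a+1−2, a+1, a−2, a` for `a = stagPhase x`, i.e. the dynamic conditions are `a = 2, 0, 3, 1`. [folklore] -/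
theorem forestRow_stagger_spatial (hL : 4 ≤ L) (x : Site 4 L) {i : Fin 4} (hi : i < 3) :
    forestRow (staggerForest L) (x.shift 3, i) ≤ 15 := by
  classical
  have hL1 : 1 < L := by omega
  have hi3 : i ≠ 3 := ne_of_lt hi
  -- the plaquettes above (`qp`, `e = tLink1 qp`) and below (`qm`, `e = tLink3 qm`) the link in the `(i,3)` plane
  set qp : Plaquette 4 L := (x.shift 3, ⟨(i, 3), hi⟩) with hqp
  set qm : Plaquette 4 L := (x, ⟨(i, 3), hi⟩) with hqm
  have hep : (x.shift 3, i) = tLink1 qp := rfl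
  have hem : (x.shift 3, i) = tLink3 qm := rfl
  have hne : qp ≠ qm := by
    intro h
    have h1 : x.shift 3 = x := congrArg Prod.fst h
    exact shift_ne_self hL1 x 3 h1
  have hQ : ({qp, qm} : Finset (Plaquette 4 L)) ⊆ plaqsThrough (x.shift 3, i) := by
    intro q hq
    rcases Finset.mem_insert.1 hq with rfl | hq
    · exact mem_plaqsThrough.2 (by rw [plaqEdgesT_eq, hep]; exact mem_insert_self _ _)
    · rw [Finset.mem_singleton] at hq
      subst hq
      exact mem_plaqsThrough.2 (by
        rw [plaqEdgesT_eq, hem]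
        exact mem_insert_of_mem (mem_insert_of_mem (mem_insert_self _ _)))
  refine forestRow_le_fifteen_of_witness _ _ hQ ?_
  rw [sum_pair hne, card_pair hne]
  -- the staple links of the two plaquettes, slot by slot
  have sp : tstapleLinks qp (x.shift 3, i) = ![tLink2 qp, tLink3 qp, tLink4 qp] := by
    rw [hep]; exact tstapleLinks_tLink1 qp
  have sm : tstapleLinks qm (x.shift 3, i) = ![tLink2 qm, tLink1 qm, tLink4 qm] := by
    rw [hem]; exact tstapleLinks_tLink3 hL1 qm
  have e2 : (stagPhase x + 1 - 2 = 1) ↔ stagPhase x = 2 := by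
    constructor <;> intro h <;> linear_combination h
  have e0 : (stagPhase x + 1 = 1) ↔ stagPhase x = 0 := by
    constructor <;> intro h <;> linear_combination h
  have e3 : (stagPhase x - 2 = 1) ↔ stagPhase x = 3 := by
    constructor <;> intro h <;> linear_combination h
  simp only [freeSlots_eq, sp, sm, Matrix.cons_val_zero, Matrix.cons_val_one, Matrix.head_cons, Matrix.cons_val_two,
    Matrix.tail_cons]
  simp only [hqp, hqm, tLink1, tLink2, tLink3, tLink4, temporal_not_mem_staggerForest, stagPhase_shift_ne hi3,
    stagPhase_shift_three, spatial_not_mem_staggerForest hi3, not_false_eq_true, ite_true, e2, e0, e3]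
  have := indicator_four_le_one hL (stagPhase x)
  omega

/-- **Dynamic time-like links have forest row `≤ 15`** (`L ≥ 3`; in fact `= 12`): if `e = (x, 3)` is dynamic
(`stagPhase x = 1`) then on each of the three plaquettes `(x, (j,3))` the time-like staple link `(x + e_j, 3)` has
phase `1 − 2 ≠ 1` and is frozen. [folklore] -/
theorem forestRow_stagger_temporal (hL : 4 ≤ L) (x : Site 4 L) (hx : (x, (3 : Fin 4)) ∉ staggerForest L) :
    forestRow (staggerForest L) (x, 3) ≤ 15 := by
  classical
  have hL1 : 1 < L := by omega
  obtain ⟨-, h02, -, -, -, -⟩ := zmod_small_ne hL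
  rw [temporal_not_mem_staggerForest] at hx
  -- the three plaquettes `(x, (j,3))`, `j = 0, 1, 2`, each with `e = tLink4`
  have hno : ¬ ((1 : ZMod L) - 2 = 1) := fun h => h02 (by linear_combination h)
  have hfree : ∀ (j : Fin 4) (hj : j < 3),
      freeSlots (staggerForest L) (x, 3) (x, ⟨(j, 3), hj⟩) = 2 := by
    intro j hj
    have hj3 : j ≠ 3 := ne_of_lt hj
    have he : ((x, 3) : Edge 4 L) = tLink4 ((x, ⟨(j, 3), hj⟩) : Plaquette 4 L) := rfl
    have s4 : tstapleLinks ((x, ⟨(j, 3), hj⟩) : Plaquette 4 L) (x, 3) =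
        ![tLink3 (x, ⟨(j, 3), hj⟩), tLink2 (x, ⟨(j, 3), hj⟩), tLink1 (x, ⟨(j, 3), hj⟩)] := by
      rw [he]; exact tstapleLinks_tLink4 hL1 _
    simp only [freeSlots_eq, s4, Matrix.cons_val_zero, Matrix.cons_val_one, Matrix.head_cons, Matrix.cons_val_two,
      Matrix.tail_cons]
    simp only [tLink1, tLink2, tLink3, temporal_not_mem_staggerForest, stagPhase_shift_ne hj3, hx, hno,
      spatial_not_mem_staggerForest hj3, not_false_eq_true, ite_true, ite_false]
  set q0 : Plaquette 4 L := (x, ⟨(0, 3), by decide⟩) with hq0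
  set q1 : Plaquette 4 L := (x, ⟨(1, 3), by decide⟩) with hq1
  set q2 : Plaquette 4 L := (x, ⟨(2, 3), by decide⟩) with hq2
  have h01 : q0 ≠ q1 := fun h => by simpa [hq0, hq1] using congrArg (fun q : Plaquette 4 L => q.2.1.1) h
  have h02' : q0 ≠ q2 := fun h => by simpa [hq0, hq2] using congrArg (fun q : Plaquette 4 L => q.2.1.1) h
  have h12 : q1 ≠ q2 := fun h => by simpa [hq1, hq2] using congrArg (fun q : Plaquette 4 L => q.2.1.1) h
  have hmem : ∀ (j : Fin 4) (hj : j < 3), ((x, ⟨(j, 3), hj⟩) : Plaquette 4 L) ∈ plaqsThrough ((x, 3) : Edge 4 L) :=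
    fun j hj => mem_plaqsThrough.2 (by
      rw [plaqEdgesT_eq]
      exact mem_insert_of_mem (mem_insert_of_mem (mem_insert_of_mem (mem_singleton_self _))))
  have hQ : ({q0, q1, q2} : Finset (Plaquette 4 L)) ⊆ plaqsThrough ((x, 3) : Edge 4 L) := by
    intro q hq
    simp only [Finset.mem_insert, Finset.mem_singleton] at hq
    rcases hq with rfl | rfl | rfl
    · exact hmem 0 (by decide)
    · exact hmem 1 (by decide)
    · exact hmem 2 (by decide)
  refine forestRow_le_fifteen_of_witness _ _ hQ ?_
  have hnot : q0 ∉ ({q1, q2} : Finset (Plaquette 4 L)) := by simp [h01, h02']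
  rw [sum_insert hnot, sum_pair h12, card_insert_of_notMem hnot, card_pair h12]
  rw [hq0, hq1, hq2, hfree 0 (by decide), hfree 1 (by decide), hfree 2 (by decide)]
  norm_num

/-- **F1-15, per volume**: on every torus of side `L ≥ 4` the staggered temporal forest has forest row bound `15`.
[folklore] -/
theorem forestRowBound_stagger (hL : 4 ≤ L) : ForestRowBound (staggerForest L) 15 := by
  intro e he
  obtain ⟨z, i⟩ := e
  fin_cases i
  · have h := forestRow_stagger_spatial hL (z - Pi.single 3 1) (i := 0) (by decide)
    simpa [Site.shift] using h
  · have h := forestRow_stagger_spatial hL (z - Pi.single 3 1) (i := 1) (by decide)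
    simpa [Site.shift] using h
  · have h := forestRow_stagger_spatial hL (z - Pi.single 3 1) (i := 2) (by decide)
    simpa [Site.shift] using h
  · exact forestRow_stagger_temporal hL z he

/-- Along a frozen time-like link the staggered rank drops by exactly one towards the later site. [folklore] -/
theorem stagRank_shift_three {x : Site 4 L} (hL : 1 < L) (hx : (x, (3 : Fin 4)) ∈ staggerForest L) :
    stagRank (x.shift 3) + 1 = stagRank x := by
  haveI : Fact (1 < L) := ⟨hL⟩
  rw [mem_staggerForest] at hx
  have hne : stagTime x - x 3 ≠ 0 := fun h => hx.2 (sub_eq_zero.1 h).symm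
  have hpos : 0 < (stagTime x - x 3).val := (ZMod.val_pos).2 hne
  have hshift : stagTime (x.shift 3) - (x.shift 3) 3 = (stagTime x - x 3) - 1 := by
    rw [stagTime_shift_three]
    simp [Site.shift]
    ring
  unfold stagRank
  rw [hshift, ZMod.val_sub (by rw [ZMod.val_one]; exact hpos), ZMod.val_one]
  omega

/-- **The staggered temporal forest is a ranked link forest** (`L ≥ 2`), for the staggered rank. [folklore] -/
theorem isRankedForest_stagger (hL : 1 < L) : IsRankedForest (staggerForest L) stagRank := by
  have hup : ∀ e ∈ staggerForest L, stagRank (e.1.shift e.2) < stagRank e.1 ∧ upperEnd stagRank e = e.1 := by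
    rintro ⟨x, i⟩ he
    have hi : i = 3 := (mem_staggerForest.1 he).1
    subst hi
    have h := stagRank_shift_three hL he
    refine ⟨by simp only; omega, ?_⟩
    simp only [upperEnd]
    rw [if_pos (by omega)]
  refine ⟨fun e he => (hup e he).1.ne', fun e he f hf h => ?_⟩
  rw [(hup e he).2, (hup f hf).2] at h
  have h2 : e.2 = f.2 := by rw [(mem_staggerForest.1 he).1, (mem_staggerForest.1 hf).1]
  exact Prod.ext h h2

end Stagger

/-- **F1-15 (the combinatorial rung, PROVED)**: `EventualForestRowBound 15`, witnessed from side `5` on by the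
staggered temporal forest with its staggered rank. [folklore] -/
theorem eventualForestRowBound_fifteen : EventualForestRowBound 15 :=
  ⟨2, fun S hS => ⟨staggerForest (2 * S + 1), stagRank, isRankedForest_stagger (by omega),
    forestRowBound_stagger (by omega)⟩⟩

/-- **Row bound `15` what-if, combinatorics DISCHARGED**: given the forest Dobrushin door (F2+F3) and the quarter
modulus up to `4/15` (F4), the strong-coupling front holds at every Wilson `0 ≤ β_W < 4/15 = 0.2667`
(`2/9 = 0.2222 < 4/15`). [folklore] -/
theorem su2_strongCouplingFront_whatIf15 (hdoor : ForestDobrushinDoor) (hquarter : QuarterModulusUpTo (4 / 15))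
    {β₀W : ℝ} (h0 : 0 ≤ β₀W) (hlt : β₀W < 4 / 15) :
    CrossoverLedger.StrongCouplingFront (fundamentalLatticeRep 2) (β₀W / 2) :=
  su2_strongCouplingFront_of_forestDoor hdoor (D := 15) (by norm_num) eventualForestRowBound_fifteen
    (by simpa using hquarter) h0 (by simpa using hlt)

end Summit.QuantumFields.BalabanUV.InfraRed.StrongCouplingStaggerForest
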